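import Summits.NavierStokesRegularity.NavierStokesRegularity.Theorems.TypeICertificateLadderTargetStrainCubePointwise
import HarnessLib

/-!
# Crux `Target` = `TypeICertificateLadder.NoTypeIBlowup` (stmt-NavierStokesRegularity-1217), line
# `depletion-ladder`: THE OPERATOR-NORM GAIN `|S e| ≤ √(2/3) |S|_F |e|` FOR TRACE-FREE STRAINS

`--supports stmt-NavierStokesRegularity-1217` (algebra for the sharpened depletion constant
`κ = (2+√3)/9 ≈ 0.4147`, i.e. rungs `C < 18 − 9√3 ≈ 2.41`, improving the landed `(√3+√6)/9`):
for a symmetric trace-free `3 × 3` array `s` (the strain of a divergence-free field),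

* `sq_quadForm_sym_le` — `(eᵀ s e)² ≤ (2/3) |s|² |e|⁴` (Cauchy–Schwarz in the space of matrices
  against the trace-free test matrix `e eᵀ − (|e|²/3) I`, whose squared norm is `(2/3)|e|⁴`);
* `abs_bilin_sym_le` — `|vᵀ s z| ≤ √(2/3) √(|s|²) ‖v‖ ‖z‖` (polarisation of the previous bound at
  `‖z‖v ± ‖v‖z`): the largest eigenvalue of a trace-free symmetric matrix is at most `√(2/3)` of its
  Frobenius norm, proved without spectral theory.

Pure finite algebra. WHAT THIS IS NOT: no analysis; consumed by the sharpened cube interpolation.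
[folklore]
-/

noncomputable section

open Finset

namespace Summit.NavierStokesRegularity.NavierStokesRegularity.Theorems.DepletionLadder.StrainCube

-- the problem directory repeats the summit name (`NavierStokesRegularity/NavierStokesRegularity`)
set_option linter.dupNamespace false

variable (s : Fin 3 → Fin 3 → ℝ)

/-- **`(eᵀ s e)² ≤ (2/3)|s|²|e|⁴`** for a symmetric trace-free array `s`. [folklore] -/
theorem sq_quadForm_sym_le (htr : s 0 0 + s 1 1 + s 2 2 = 0) (e : Fin 3 → ℝ) :
    (∑ i, ∑ j, e i * s i j * e j) ^ 2 ≤ (2 / 3) * (∑ i, ∑ j, s i j ^ 2) * (∑ i, e i ^ 2) ^ 2 := by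
  -- the trace-free test matrix `E = e eᵀ − (|e|²/3) I`
  set n : ℝ := ∑ i, e i ^ 2 with hn
  set E : Fin 3 → Fin 3 → ℝ := fun i j => e i * e j - (if i = j then n / 3 else 0) with hE
  have hcs := sq_sum_sum_mul_le s E
  have h1 : ∑ i, ∑ j, s i j * E i j = ∑ i, ∑ j, e i * s i j * e j := by
    simp only [hE, hn, Fin.sum_univ_three, Fin.isValue]
    simp only [if_true]
    have h01 : ((0 : Fin 3) = 1) = False := by simp
    have h02 : ((0 : Fin 3) = 2) = False := by simp
    have h10 : ((1 : Fin 3) = 0) = False := by simp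
    have h12 : ((1 : Fin 3) = 2) = False := by simp
    have h20 : ((2 : Fin 3) = 0) = False := by simp
    have h21 : ((2 : Fin 3) = 1) = False := by simp
    simp only [h01, h02, h10, h12, h20, h21, if_false]
    have h00 : s 0 0 = -(s 1 1 + s 2 2) := by linarith
    rw [h00]; ring
  have h2 : ∑ i, ∑ j, E i j ^ 2 = (2 / 3) * n ^ 2 := by
    simp only [hE, hn, Fin.sum_univ_three, Fin.isValue]
    simp only [if_true]
    have h01 : ((0 : Fin 3) = 1) = False := by simp
    have h02 : ((0 : Fin 3) = 2) = False := by simp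
    have h10 : ((1 : Fin 3) = 0) = False := by simp
    have h12 : ((1 : Fin 3) = 2) = False := by simp
    have h20 : ((2 : Fin 3) = 0) = False := by simp
    have h21 : ((2 : Fin 3) = 1) = False := by simp
    simp only [h01, h02, h10, h12, h20, h21, if_false]
    ring
  rw [h1, h2] at hcs
  calc (∑ i, ∑ j, e i * s i j * e j) ^ 2 ≤ (∑ i, ∑ j, s i j ^ 2) * ((2 / 3) * n ^ 2) := hcs
    _ = (2 / 3) * (∑ i, ∑ j, s i j ^ 2) * n ^ 2 := by ring

/-- `|eᵀ s e| ≤ √(2/3) √(|s|²) |e|²`. [folklore] -/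
theorem abs_quadForm_sym_le (htr : s 0 0 + s 1 1 + s 2 2 = 0) (e : Fin 3 → ℝ) :
    |∑ i, ∑ j, e i * s i j * e j| ≤
      Real.sqrt (2 / 3) * Real.sqrt (∑ i, ∑ j, s i j ^ 2) * (∑ i, e i ^ 2) := by
  have hq0 : 0 ≤ ∑ i, ∑ j, s i j ^ 2 := sum_nonneg fun _ _ => sum_nonneg fun _ _ => sq_nonneg _
  have hn0 : 0 ≤ ∑ i, e i ^ 2 := sum_nonneg fun _ _ => sq_nonneg _
  refine abs_le_of_sq_le_sq ?_ (by positivity)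
  calc (∑ i, ∑ j, e i * s i j * e j) ^ 2 ≤ (2 / 3) * (∑ i, ∑ j, s i j ^ 2) * (∑ i, e i ^ 2) ^ 2 :=
        sq_quadForm_sym_le s htr e
    _ = (Real.sqrt (2 / 3) * Real.sqrt (∑ i, ∑ j, s i j ^ 2) * (∑ i, e i ^ 2)) ^ 2 := by
        rw [mul_pow, mul_pow, Real.sq_sqrt (by norm_num), Real.sq_sqrt hq0]

/-- **The operator-norm gain**: `|Σᵢ vᵢ Σⱼ sᵢⱼ zⱼ| ≤ √(2/3) · √(Σ sᵢⱼ²) · √(Σ vᵢ²) · √(Σ zⱼ²)` for a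
symmetric trace-free array (polarisation of `abs_quadForm_sym_le` at `‖z‖v ± ‖v‖z`). [folklore] -/
theorem abs_bilin_sym_le (hsym : ∀ i j, s i j = s j i) (htr : s 0 0 + s 1 1 + s 2 2 = 0)
    (v z : Fin 3 → ℝ) :
    |∑ i, v i * ∑ j, s i j * z j| ≤
      Real.sqrt (2 / 3) * Real.sqrt (∑ i, ∑ j, s i j ^ 2) * Real.sqrt (∑ i, v i ^ 2) *
        Real.sqrt (∑ j, z j ^ 2) := by
  set A : ℝ := Real.sqrt (2 / 3) * Real.sqrt (∑ i, ∑ j, s i j ^ 2) with hA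
  set a : ℝ := Real.sqrt (∑ i, v i ^ 2) with ha
  set b : ℝ := Real.sqrt (∑ j, z j ^ 2) with hb
  set B : ℝ := ∑ i, v i * ∑ j, s i j * z j with hB
  have hA0 : 0 ≤ A := by positivity
  have ha0 : 0 ≤ a := Real.sqrt_nonneg _
  have hb0 : 0 ≤ b := Real.sqrt_nonneg _
  have hv2 : ∑ i, v i ^ 2 = a ^ 2 := (Real.sq_sqrt (sum_nonneg fun _ _ => sq_nonneg _)).symm
  have hz2 : ∑ j, z j ^ 2 = b ^ 2 := (Real.sq_sqrt (sum_nonneg fun _ _ => sq_nonneg _)).symm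
  -- the quadratic form at `b v ± a z`
  have quad : ∀ x : Fin 3 → ℝ, |∑ i, ∑ j, x i * s i j * x j| ≤ A * ∑ i, x i ^ 2 :=
    fun x => abs_quadForm_sym_le s htr x
  have hp := quad (fun i => b * v i + a * z i)
  have hm := quad (fun i => b * v i - a * z i)
  -- expansions
  have qv : ∑ i, ∑ j, v i * s i j * v j = ∑ i, ∑ j, v i * s i j * v j := rfl
  have symB : ∑ i, ∑ j, z i * s i j * v j = B := by
    rw [hB, Finset.sum_comm]
    simp only [Finset.mul_sum]
    refine Finset.sum_congr rfl fun i _ => Finset.sum_congr rfl fun j _ => ?_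
    rw [hsym j i]; ring
  have eB : ∑ i, ∑ j, v i * s i j * z j = B := by
    rw [hB]; simp only [Finset.mul_sum]
    exact Finset.sum_congr rfl fun i _ => Finset.sum_congr rfl fun j _ => by ring
  have ep : ∑ i, ∑ j, (b * v i + a * z i) * s i j * (b * v j + a * z j) =
      b ^ 2 * (∑ i, ∑ j, v i * s i j * v j) + 2 * a * b * B + a ^ 2 * ∑ i, ∑ j, z i * s i j * z j := by
    have : ∀ i j, (b * v i + a * z i) * s i j * (b * v j + a * z j) =
        b ^ 2 * (v i * s i j * v j) + a * b * (v i * s i j * z j) + a * b * (z i * s i j * v j) +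
          a ^ 2 * (z i * s i j * z j) := fun i j => by ring
    simp only [this, Finset.sum_add_distrib, ← Finset.mul_sum, eB, symB]; ring
  have em : ∑ i, ∑ j, (b * v i - a * z i) * s i j * (b * v j - a * z j) =
      b ^ 2 * (∑ i, ∑ j, v i * s i j * v j) - 2 * a * b * B + a ^ 2 * ∑ i, ∑ j, z i * s i j * z j := by
    have : ∀ i j, (b * v i - a * z i) * s i j * (b * v j - a * z j) =
        b ^ 2 * (v i * s i j * v j) - a * b * (v i * s i j * z j) - a * b * (z i * s i j * v j) +
          a ^ 2 * (z i * s i j * z j) := fun i j => by ring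
    simp only [this, Finset.sum_add_distrib, Finset.sum_sub_distrib, ← Finset.mul_sum, eB, symB]; ring
  have np : ∑ i, (b * v i + a * z i) ^ 2 = 2 * a ^ 2 * b ^ 2 + 2 * a * b * ∑ i, v i * z i := by
    have : ∀ i, (b * v i + a * z i) ^ 2 = b ^ 2 * v i ^ 2 + a ^ 2 * z i ^ 2 + 2 * a * b * (v i * z i) :=
      fun i => by ring
    simp only [this, Finset.sum_add_distrib, ← Finset.mul_sum, hv2, hz2]; ring
  have nm : ∑ i, (b * v i - a * z i) ^ 2 = 2 * a ^ 2 * b ^ 2 - 2 * a * b * ∑ i, v i * z i := by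
    have : ∀ i, (b * v i - a * z i) ^ 2 = b ^ 2 * v i ^ 2 + a ^ 2 * z i ^ 2 - 2 * a * b * (v i * z i) :=
      fun i => by ring
    simp only [this, Finset.sum_add_distrib, Finset.sum_sub_distrib, ← Finset.mul_sum, hv2, hz2]; ring
  rw [ep, np] at hp
  rw [em, nm] at hm
  -- `4ab·B = Q(bv+az) − Q(bv−az)`, so `4ab|B| ≤ 4A a²b²`
  have key : a * b * |B| ≤ A * a ^ 2 * b ^ 2 := by
    have h1 := (abs_le.1 hp).2
    have h2 := (abs_le.1 hm).1
    have h3 := (abs_le.1 hp).1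
    have h4 := (abs_le.1 hm).2
    have e : a * b * |B| = |a * b * B| := by rw [abs_mul, abs_of_nonneg (mul_nonneg ha0 hb0)]
    rw [e, abs_le]
    constructor <;> nlinarith
  -- conclude: if `a b > 0` divide; otherwise `B = 0`
  rcases eq_or_lt_of_le ha0 with ha' | ha'
  · -- `a = 0`: `v = 0`
    have hv0 : ∀ i, v i = 0 := by
      intro i
      have hs0 : ∑ i, v i ^ 2 = 0 := by rw [hv2, ← ha']; ring
      have := (Finset.sum_eq_zero_iff_of_nonneg fun j _ => sq_nonneg (v j)).1 hs0 i (Finset.mem_univ i)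
      exact pow_eq_zero_iff (n := 2) (by norm_num) |>.1 this
    have hB0 : B = 0 := by rw [hB]; simp [hv0]
    rw [hB0, abs_zero]; positivity
  rcases eq_or_lt_of_le hb0 with hb' | hb'
  · have hz0 : ∀ j, z j = 0 := by
      intro j
      have hs0 : ∑ j, z j ^ 2 = 0 := by rw [hz2, ← hb']; ring
      have := (Finset.sum_eq_zero_iff_of_nonneg fun j _ => sq_nonneg (z j)).1 hs0 j (Finset.mem_univ j)
      exact pow_eq_zero_iff (n := 2) (by norm_num) |>.1 this
    have hB0 : B = 0 := by rw [hB]; simp [hz0]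
    rw [hB0, abs_zero]; positivity
  have hab : 0 < a * b := mul_pos ha' hb'
  have := key
  calc |B| = (a * b * |B|) / (a * b) := by field_simp
    _ ≤ (A * a ^ 2 * b ^ 2) / (a * b) := div_le_div_of_nonneg_right key hab.le
    _ = A * a * b := by field_simp

end Summit.NavierStokesRegularity.NavierStokesRegularity.Theorems.DepletionLadder.StrainCube

end
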